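import Mathlib

/-!
# `SnSubsetDichotomy.HyperoctahedralSubsets`, line `spherical-rank-sieve` — SURGERY TRANSFER

Helper for crux `stmt-MatrixMultiplication-8305` (lead c1).  The open core of the line (the matching
lemma: `≥ c√n` support-disjoint commuting local triples in every triple of fixed-point-free involutions
`μ 0, μ 1, μ 2` of `Fin n`) is attacked in BULK form by recursion over pieces of the 3-edge-coloured
cubic graph `M₀ ∪ M₁ ∪ M₂` (sparse cuts, traps, components): one cuts a vertex set out, RE-MATCHES the
"scar" vertices whose partners were cut away, finds local triples in the re-matched host and keeps
those that avoid the scars.  This file proves the step that makes the recursion sound: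

* `comm_of_comm_of_agree_off` — if two involutions `μ, μ'` agree outside a set `Z` and a permutation
  `a` commutes with `μ'` and moves no point of `Z`, then `a` commutes with `μ`.  (At a moved point `v`
  both `v` and `a v` are off `Z`; at a fixed point `v`, if `w = μ v` were moved then `w ∉ Z`, so
  `μ' w = μ w = v`, hence `μ' v = w`, and commuting at `w` gives `a w = μ' (a v) = μ' v = w` — absurd.)
* `stub_surgeryTransfer` — consequently a family of commuting local triples of a re-matched host
  `μ'` (involutions agreeing with `μ` off the scar set `Z`) whose supports avoid `Z` is a family of
  commuting local triples of `μ`, verbatim in the input format of the landed bridge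
  `stub_triplesToGroup` (p79923); support-disjointness is untouched.

No fixed-point-freeness is needed.  [folklore; the surgery scheme is the twin lead's (crux 10883
NOTES §7.8) and lead -1's (PICKED.md, "superadditive recursion over pieces")]
-/

-- the project's summit namespace `Summit.MatrixMultiplication.MatrixMultiplication` repeats a component by design (D-0022)
set_option linter.dupNamespace false

namespace Summit.MatrixMultiplication.MatrixMultiplication.Theorems.HyperoctahedralSubsets

open Equiv Equiv.Perm

namespace SurgeryTransfer

variable {α : Type*}

/-- **Transfer of commutation across a re-matching.**  Let `μ, μ'` be involutions of `α` that agree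
outside `Z`, and let `a` commute with `μ'` and move no point of `Z`.  Then `a` commutes with `μ`.
[folklore] -/
theorem comm_of_comm_of_agree_off (μ μ' a : Perm α) (Z : Set α) (hμ : μ * μ = 1)
    (hμ' : μ' * μ' = 1) (hagree : ∀ v, v ∉ Z → μ' v = μ v) (ha : a * μ' = μ' * a)
    (hsupp : ∀ v, a v ≠ v → v ∉ Z) : a * μ = μ * a := by
  have hμμ : ∀ y, μ (μ y) = y := fun y => by rw [← Perm.mul_apply, hμ, Perm.one_apply]
  have hμ'μ' : ∀ y, μ' (μ' y) = y := fun y => by rw [← Perm.mul_apply, hμ', Perm.one_apply]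
  have hcomm : ∀ y, a (μ' y) = μ' (a y) := fun y => by
    have := congrArg (fun σ : Perm α => σ y) ha
    simpa using this
  have hmoved : ∀ y, a y ≠ y → a (a y) ≠ a y := fun y hy h => hy (a.injective h)
  ext v
  simp only [Perm.coe_mul, Function.comp_apply]
  by_cases hv : a v = v
  · -- `v` fixed: `μ v` must be fixed too
    rw [hv]
    by_contra hw
    -- `w := μ v` is moved by `a`, hence off `Z`
    have hw' : a (μ v) ≠ μ v := fun h => hw h
    have hwZ : μ v ∉ Z := hsupp _ hw'
    have e1 : μ' (μ v) = v := by rw [hagree _ hwZ, hμμ]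
    have e2 : μ' v = μ v := by
      have := congrArg μ' e1
      rw [hμ'μ'] at this
      exact this.symm
    have e3 : a (μ' (μ v)) = μ' (a (μ v)) := hcomm (μ v)
    rw [e1, hv] at e3
    -- `e3 : v = μ' (a (μ v))`, so `μ' v = a (μ v)`, i.e. `a (μ v) = μ v`
    have e4 : μ' v = a (μ v) := by
      have := congrArg μ' e3
      rw [hμ'μ'] at this
      exact this
    exact hw' (by rw [← e4, e2])
  · -- `v` moved: `v` and `a v` are off `Z`, where `μ' = μ`
    have hvZ : v ∉ Z := hsupp v hv
    have havZ : a v ∉ Z := hsupp (a v) (hmoved v hv)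
    rw [← hagree v hvZ, ← hagree (a v) havZ]
    exact hcomm v

/-- One commuting local triple transfers across a re-matching: if `μ c, μ' c` (`c = 0, 1, 2`) are
involutions agreeing outside `Z` and `(a, b)` is a commuting local triple for `μ'` whose support avoids
`Z`, then `(a, b)` is a commuting local triple for `μ`. [folklore] -/
theorem localTriple_transfer (μ μ' : Fin 3 → Perm α) (Z : Set α) (hμ : ∀ c, μ c * μ c = 1)
    (hμ' : ∀ c, μ' c * μ' c = 1) (hagree : ∀ c v, v ∉ Z → μ' c v = μ c v) (a b : Perm α)
    (h : a * a = 1 ∧ b * b = 1 ∧ a * b = b * a ∧ (a ≠ 1 ∨ b ≠ 1) ∧ a * μ' 0 = μ' 0 * a ∧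
      b * μ' 1 = μ' 1 * b ∧ a * b * μ' 2 = μ' 2 * (a * b))
    (hsupp : ∀ v, (a v ≠ v ∨ b v ≠ v) → v ∉ Z) :
    a * a = 1 ∧ b * b = 1 ∧ a * b = b * a ∧ (a ≠ 1 ∨ b ≠ 1) ∧ a * μ 0 = μ 0 * a ∧
      b * μ 1 = μ 1 * b ∧ a * b * μ 2 = μ 2 * (a * b) := by
  obtain ⟨haa, hbb, hab, hne, ha0, hb1, hab2⟩ := h
  refine ⟨haa, hbb, hab, hne, ?_, ?_, ?_⟩
  · exact comm_of_comm_of_agree_off (μ 0) (μ' 0) a Z (hμ 0) (hμ' 0) (hagree 0) ha0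
      (fun v hv => hsupp v (Or.inl hv))
  · exact comm_of_comm_of_agree_off (μ 1) (μ' 1) b Z (hμ 1) (hμ' 1) (hagree 1) hb1
      (fun v hv => hsupp v (Or.inr hv))
  · refine comm_of_comm_of_agree_off (μ 2) (μ' 2) (a * b) Z (hμ 2) (hμ' 2) (hagree 2) hab2 ?_
    intro v hv
    apply hsupp v
    by_contra hcon
    obtain ⟨h1, h2⟩ := not_or.1 hcon
    apply hv
    rw [Perm.mul_apply, not_not.1 h2, not_not.1 h1]

end SurgeryTransfer

open SurgeryTransfer in
/-- **Surgery transfer for families of local triples** (crux `SnSubsetDichotomy.HyperoctahedralSubsets`,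
stmt-MatrixMultiplication-8305, line `spherical-rank-sieve`).  Let `μ c` and `μ' c` (`c = 0, 1, 2`) be
involutions of `Fin n` that agree outside the scar set `Z` (a re-matching of the host `μ` at `Z`).  Then
every family of commuting local triples `(a j, b j)` for `μ'` — commuting involutions, not both trivial,
`a j ∈ C(μ' 0)`, `b j ∈ C(μ' 1)`, `a j · b j ∈ C(μ' 2)` — whose supports avoid `Z` is a family of
commuting local triples for `μ` (same data, so support-disjointness is inherited verbatim); together with
the landed bridge `stub_triplesToGroup` this is what a recursion over re-matched pieces needs.
Proof: `localTriple_transfer` for each `j`. [folklore] -/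
theorem stub_surgeryTransfer :
    ∀ (n : ℕ) (μ μ' : Fin 3 → Equiv.Perm (Fin n)) (Z : Finset (Fin n)),
      (∀ c, μ c * μ c = 1) → (∀ c, μ' c * μ' c = 1) → (∀ c, ∀ v ∉ Z, μ' c v = μ c v) →
      ∀ (g : ℕ) (a b : Fin g → Equiv.Perm (Fin n)),
        (∀ j, a j * a j = 1 ∧ b j * b j = 1 ∧ a j * b j = b j * a j ∧ (a j ≠ 1 ∨ b j ≠ 1) ∧
          a j * μ' 0 = μ' 0 * a j ∧ b j * μ' 1 = μ' 1 * b j ∧ a j * b j * μ' 2 = μ' 2 * (a j * b j)) →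
        (∀ j v, (a j v ≠ v ∨ b j v ≠ v) → v ∉ Z) →
        (∀ j, a j * a j = 1 ∧ b j * b j = 1 ∧ a j * b j = b j * a j ∧ (a j ≠ 1 ∨ b j ≠ 1) ∧
          a j * μ 0 = μ 0 * a j ∧ b j * μ 1 = μ 1 * b j ∧ a j * b j * μ 2 = μ 2 * (a j * b j)) := by
  intro n μ μ' Z hμ hμ' hagree g a b htrip hsupp j
  exact localTriple_transfer μ μ' (↑Z : Set (Fin n)) hμ hμ'
    (fun c v hv => hagree c v (by exact_mod_cast hv)) (a j) (b j) (htrip j)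
    (fun v hv => by exact_mod_cast hsupp j v hv)

end Summit.MatrixMultiplication.MatrixMultiplication.Theorems.HyperoctahedralSubsets
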